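import Mathlib
import HarnessLib
import Literature.Analysis.FluidPDE.CurlFreeLiouville
import Summits.NavierStokesRegularity.NavierStokesRegularity.Theorems.UnthreadedDoorAntidynamoHarmonicPolynomialGrowth

/-!
# Route `UnthreadedDoor` / `ThreadingFlux`, crux `PoloidalLiouville` (stmt-NavierStokesRegularity-1222), antidynamo v2 skeleton,
# rung `stub_singleDegreeRung`, EVEN degree — input (E1b′): HARMONIC FIELDS OF GROWTH `O(r log r)` ARE AFFINE, and a curl-free,
# divergence-free affine field has a SYMMETRIC TRACE-FREE linear part

Support file (census instrument decomp-ns-census-1 g34, cell decomp-ns; `--supports stmt-NavierStokesRegularity-1222 --as helper`; 0 kit).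

PURE LEMMA.  The kinematic remainder of an even slice, `w = u(x₀ + ·) − (aP)•y − k•∇P` (radial profiles of p813766), is harmonic and, because
the `∇P`-coefficient `k` grows logarithmically when `l = 2`, only of growth `‖w(y)‖ ≤ A + B‖y‖(1 + |log ‖y‖|)` — NOT linear, so the tree's
linear-growth Liouville (`affine_of_curl_eq_zero_of_isDivFree_of_linear_growth`, p799281) does not apply verbatim.  THIS FILE closes the gap with
the tree's polynomial-growth Liouville (`iteratedFDeriv_eq_of_laplacian_eq_zero_of_polynomial_growth`, p799781, `N = 2`):

* `mul_one_add_abs_log_le` — `r(1 + |log r|) ≤ 2(1 + r)²` (`r ≥ 0`);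
* `eq_taylor_two_of_fderiv_fderiv_const` — a smooth map with CONSTANT second derivative `L` is the quadratic polynomial
  `W x = W 0 + DW(0)x + ½ L x x`;
* ★ `eq_add_fderiv_of_laplacian_eq_zero_of_log_growth` — smooth `W : E → F` with `ΔW = 0` and `‖W x‖ ≤ A + B‖x‖(1 + |log ‖x‖|)` is AFFINE:
  `W x = W 0 + DW(0)x` (the quadratic term `½ L y y·s²` is `o(s²)` along every ray, `log t ≤ 2√t`);
* `inner_clm_comm_of_curlCLM_eq_zero` — `curlCLM T = 0` ⟹ `⟪Ty, z⟫ = ⟪y, Tz⟫`;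
* ★★ `affine_symm_traceFree_of_curl_div_log_growth` — THE EXPORT: a smooth curl-free divergence-free field on `ℝ³` with the log growth is
  `W x = W 0 + T x` with `T = DW(0)` symmetric and trace-free — exactly the input of the strain kill `strainKill` (p813842, (E1c)).

HONEST LABEL: elementary calculus on top of the tree's Liouville theorems, serving the open EVEN-degree rung of an S-free Liouville engine;
the rung, the wall `stub_scalarLiouville`, `PoloidalLiouville` (1222) and Navier–Stokes regularity are NOT touched (crux 1222 is INCOMPARABLE
with the summit; descent inside the door's cone, decorative for the summit).  Nothing here proves NavierStokesRegularity. [folklore]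
-/

noncomputable section

-- the summit and its single sub-problem share the name (CONVENTIONS §1), as in every Theorems file
set_option linter.dupNamespace false

open scoped Topology InnerProductSpace RealInnerProductSpace ContDiff Laplacian
open Filter Set Metric
open Literature.Analysis.FluidPDE

namespace Summit.NavierStokesRegularity.NavierStokesRegularity.Theorems.PoloidalLiouville.Antidynamo

/-! ### The growth function -/

/-- `r (1 + |log r|) ≤ 2 (1 + r)²` for `r ≥ 0`. [folklore] -/
theorem mul_one_add_abs_log_le {r : ℝ} (hr : 0 ≤ r) : r * (1 + |Real.log r|) ≤ 2 * (1 + r) ^ 2 := by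
  rcases hr.eq_or_lt with h0 | hpos
  · rw [← h0]; norm_num
  have hrlog : r * |Real.log r| ≤ 1 + r ^ 2 := by
    rcases le_or_gt 1 r with h1 | h1
    · rw [abs_of_nonneg (Real.log_nonneg h1)]
      have := Real.log_le_sub_one_of_pos hpos
      nlinarith
    · rw [abs_of_neg (Real.log_neg hpos h1)]
      have h2 := Real.log_le_sub_one_of_pos (inv_pos.mpr hpos)
      rw [Real.log_inv] at h2
      have h3 : r * -Real.log r ≤ r * (r⁻¹ - 1) := mul_le_mul_of_nonneg_left h2 hpos.le
      rw [mul_sub, mul_inv_cancel₀ hpos.ne'] at h3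
      nlinarith
  nlinarith

section General

variable {E : Type*} [NormedAddCommGroup E] [InnerProductSpace ℝ E] [FiniteDimensional ℝ E]
  [MeasurableSpace E] [BorelSpace E]
variable {F : Type*} [NormedAddCommGroup F] [InnerProductSpace ℝ F]

/-! ### Constant second derivative ⟹ quadratic polynomial -/

omit [FiniteDimensional ℝ E] [MeasurableSpace E] [BorelSpace E] in
/-- If `W` is `C²`-differentiable with CONSTANT second derivative (`D(DW)(x) = L` for all `x`), then `DW(x) = DW(0) + L x` and
`W x = W 0 + DW(0) x + ½ L x x`. [folklore] -/
theorem eq_taylor_two_of_fderiv_fderiv_const {W : E → F} (hW : ContDiff ℝ 2 W) {L : E →L[ℝ] E →L[ℝ] F}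
    (hL : ∀ x, fderiv ℝ (fderiv ℝ W) x = L) (x : E) :
    W x = W 0 + fderiv ℝ W 0 x + (1 / 2 : ℝ) • L x x := by
  have hWd : Differentiable ℝ W := hW.differentiable (by norm_num)
  have hDWd : Differentiable ℝ (fderiv ℝ W) := (hW.fderiv_right (m := 1) (by norm_num)).differentiable (by norm_num)
  -- symmetry of `L = D²W(0)`
  have hsymm : ∀ v w, L v w = L w v := by
    intro v w
    have h := (hW.contDiffAt (x := (0 : E))).isSymmSndFDerivAt (by simp) v w
    rwa [hL 0] at h
  -- first: `DW x = DW 0 + L x`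
  have hD : ∀ y, fderiv ℝ W y = fderiv ℝ W 0 + L y := by
    intro y
    set φ : E → (E →L[ℝ] F) := fun z => fderiv ℝ W z - L z with hφ
    have hφd : Differentiable ℝ φ := hDWd.sub L.differentiable
    have hφ0 : ∀ z, fderiv ℝ φ z = 0 := by
      intro z
      rw [hφ, fderiv_fun_sub (hDWd z) L.differentiableAt, L.fderiv, hL z, sub_self]
    have hc := is_const_of_fderiv_eq_zero hφd hφ0 y 0
    simp only [hφ, map_zero, sub_zero] at hc
    rw [← hc, sub_add_cancel]
  -- second: `ψ = W − W 0 − DW(0)· − ½ L · ·` has zero derivative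
  set ψ : E → F := fun z => W z - fderiv ℝ W 0 z - (1 / 2 : ℝ) • L z z with hψ
  have hq : ∀ z, HasFDerivAt (fun y : E => L y y) (L z + L z) z := by
    intro z
    have h2 := (L.hasFDerivAt (x := z)).clm_apply (hasFDerivAt_id z)
    have he : (L z).comp (ContinuousLinearMap.id ℝ E) + L.flip (id z) = L z + L z := by
      ext v
      show L z v + L v z = L z v + L z v
      rw [hsymm v z]
    rw [he] at h2
    exact h2
  have hψd : Differentiable ℝ ψ := fun z =>
    (((hWd z).sub ((fderiv ℝ W 0).differentiableAt)).sub (((hq z).differentiableAt).const_smul _))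
  have hψ0 : ∀ z, fderiv ℝ ψ z = 0 := by
    intro z
    have h1 : HasFDerivAt ψ (fderiv ℝ W z - fderiv ℝ W 0 - (1 / 2 : ℝ) • (L z + L z)) z :=
      (((hWd z).hasFDerivAt).sub ((fderiv ℝ W 0).hasFDerivAt)).sub ((hq z).const_smul _)
    rw [h1.fderiv, hD z]
    module
  have hc := is_const_of_fderiv_eq_zero hψd hψ0 x 0
  simp only [hψ, map_zero, sub_zero, smul_zero] at hc
  -- `hc : W x - DW 0 x - ½ L x x = W 0`
  rw [← hc]
  abel

/-! ### Harmonic + growth `O(r log r)` ⟹ affine -/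

/-- ★ **HARMONIC MAPS OF GROWTH `O(r log r)` ARE AFFINE.**  A smooth `W : E → F` on a finite-dimensional real inner product space with
`ΔW ≡ 0` and `‖W x‖ ≤ A + B ‖x‖ (1 + |log ‖x‖|)` satisfies `W x = W 0 + DW(0)[x]`.  [`N = 2` polynomial-growth Liouville makes `W` a quadratic
polynomial; along the ray `s•y` the quadratic term `½ s² L y y` is dominated by `A′ + B′ s + 2B ‖y‖^{3/2} s^{3/2}`, so `L y y = 0`.] [folklore] -/
theorem eq_add_fderiv_of_laplacian_eq_zero_of_log_growth {W : E → F} (hW : ContDiff ℝ (⊤ : ℕ∞) W)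
    (hΔ : ∀ x, (Δ W) x = 0) {A B : ℝ} (hg : ∀ x, ‖W x‖ ≤ A + B * ‖x‖ * (1 + |Real.log ‖x‖|)) (x : E) :
    W x = W 0 + fderiv ℝ W 0 x := by
  -- nonnegativity bookkeeping
  have hA : 0 ≤ A := by
    have h := hg 0
    simp at h
    exact (norm_nonneg _).trans h
  -- polynomial growth of degree 2
  have hB' : ∀ y : E, B * ‖y‖ * (1 + |Real.log ‖y‖|) ≤ |B| * (2 * (1 + ‖y‖) ^ 2) := fun y =>
    calc B * ‖y‖ * (1 + |Real.log ‖y‖|) ≤ |B| * (‖y‖ * (1 + |Real.log ‖y‖|)) := by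
          rw [mul_assoc]; exact mul_le_mul_of_nonneg_right (le_abs_self B) (by positivity)
      _ ≤ |B| * (2 * (1 + ‖y‖) ^ 2) := mul_le_mul_of_nonneg_left (mul_one_add_abs_log_le (norm_nonneg y)) (abs_nonneg B)
  have hpoly : ∀ y, ‖W y‖ ≤ (A + 2 * |B|) * (1 + ‖y‖) ^ 2 := by
    intro y
    have h1 : (1 : ℝ) ≤ (1 + ‖y‖) ^ 2 := by nlinarith [norm_nonneg y]
    calc ‖W y‖ ≤ A + B * ‖y‖ * (1 + |Real.log ‖y‖|) := hg y
      _ ≤ A * (1 + ‖y‖) ^ 2 + |B| * (2 * (1 + ‖y‖) ^ 2) := add_le_add (by nlinarith) (hB' y)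
      _ = (A + 2 * |B|) * (1 + ‖y‖) ^ 2 := by ring
  -- constant second derivative
  have h2 := iteratedFDeriv_eq_of_laplacian_eq_zero_of_polynomial_growth (E := E) (F := F) 2 hW hΔ hpoly
  set L : E →L[ℝ] E →L[ℝ] F := fderiv ℝ (fderiv ℝ W) 0 with hLdef
  have hL : ∀ z, fderiv ℝ (fderiv ℝ W) z = L := by
    intro z
    ext v w
    have h := congrArg (fun M : E [×2]→L[ℝ] F => M ![v, w]) (h2 z 0)
    simp only [iteratedFDeriv_two_apply, Matrix.cons_val_zero, Matrix.cons_val_one] at h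
    exact h
  have hW2 : ContDiff ℝ 2 W := hW.of_le (by norm_cast)
  have htaylor := eq_taylor_two_of_fderiv_fderiv_const hW2 hL
  -- the quadratic term vanishes along every ray
  have hkill : ∀ y : E, L y y = 0 := by
    intro y
    by_cases hy : y = 0
    · simp [hy]
    have hny : 0 < ‖y‖ := norm_pos_iff.mpr hy
    set c : ℝ := ‖L y y‖ with hc
    set K0 : ℝ := A + ‖W 0‖ with hK0
    set K1 : ℝ := (|B| + ‖fderiv ℝ W 0‖) * ‖y‖ with hK1
    set K2 : ℝ := 2 * |B| * ‖y‖ * Real.sqrt ‖y‖ with hK2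
    -- along the ray `s • y`, `s ≥ 1/‖y‖`
    have hray : ∀ s : ℝ, 1 / ‖y‖ ≤ s → (1 / 2 : ℝ) * c * s ^ 2 ≤ K0 + K1 * s + K2 * (s * Real.sqrt s) := by
      intro s hs
      have hs0 : 0 < s := lt_of_lt_of_le (by positivity) hs
      have hsy : 1 ≤ s * ‖y‖ := by rwa [div_le_iff₀ hny] at hs
      have hns : ‖s • y‖ = s * ‖y‖ := by rw [norm_smul, Real.norm_eq_abs, abs_of_pos hs0]
      -- the quadratic term
      have hLss : L (s • y) (s • y) = (s * s) • L y y := by simp [smul_smul]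
      have hq : (1 / 2 : ℝ) • L (s • y) (s • y) = W (s • y) - W 0 - fderiv ℝ W 0 (s • y) := by rw [htaylor (s • y)]; abel
      have hn : ‖(1 / 2 : ℝ) • L (s • y) (s • y)‖ = (1 / 2 : ℝ) * c * s ^ 2 := by
        rw [hLss, norm_smul, norm_smul, Real.norm_eq_abs, Real.norm_eq_abs, abs_of_pos (by norm_num : (0 : ℝ) < 1 / 2),
          abs_of_pos (mul_pos hs0 hs0), hc]
        ring
      -- the pieces
      have hlog : |Real.log (s * ‖y‖)| ≤ 2 * Real.sqrt s * Real.sqrt ‖y‖ := by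
        rw [abs_of_nonneg (Real.log_nonneg hsy)]
        -- `log t ≤ 2√t` (the tree has it as `Literature.NumberTheory.Sieve.DFI1995.log_le_two_mul_sqrt`; one line here)
        have hlt : Real.log (s * ‖y‖) ≤ 2 * Real.sqrt (s * ‖y‖) := by
          have h := Real.log_le_rpow_div (show (0 : ℝ) ≤ s * ‖y‖ by positivity) one_half_pos
          rw [Real.sqrt_eq_rpow]
          linarith
        calc Real.log (s * ‖y‖) ≤ 2 * Real.sqrt (s * ‖y‖) := hlt
          _ = 2 * Real.sqrt s * Real.sqrt ‖y‖ := by rw [Real.sqrt_mul hs0.le]; ring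
      have hW1 : ‖W (s • y)‖ ≤ A + |B| * (s * ‖y‖) * (1 + 2 * Real.sqrt s * Real.sqrt ‖y‖) := by
        have h := hg (s • y)
        rw [hns] at h
        refine h.trans ?_
        have h1 : B * (s * ‖y‖) * (1 + |Real.log (s * ‖y‖)|) ≤ |B| * (s * ‖y‖) * (1 + |Real.log (s * ‖y‖)|) := by
          have : 0 ≤ (s * ‖y‖) * (1 + |Real.log (s * ‖y‖)|) := by positivity
          nlinarith [le_abs_self B]
        have h2 : |B| * (s * ‖y‖) * (1 + |Real.log (s * ‖y‖)|) ≤ |B| * (s * ‖y‖) * (1 + 2 * Real.sqrt s * Real.sqrt ‖y‖) := by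
          gcongr
        linarith
      have hW2 : ‖fderiv ℝ W 0 (s • y)‖ ≤ ‖fderiv ℝ W 0‖ * (s * ‖y‖) := by
        rw [← hns]; exact ContinuousLinearMap.le_opNorm _ _
      have htri : ‖W (s • y) - W 0 - fderiv ℝ W 0 (s • y)‖ ≤ ‖W (s • y)‖ + ‖W 0‖ + ‖fderiv ℝ W 0 (s • y)‖ :=
        calc _ ≤ ‖W (s • y) - W 0‖ + ‖fderiv ℝ W 0 (s • y)‖ := norm_sub_le _ _
          _ ≤ _ := by gcongr; exact norm_sub_le _ _
      have hss : Real.sqrt s * Real.sqrt s = s := Real.mul_self_sqrt hs0.le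
      rw [← hn, hq]
      calc ‖W (s • y) - W 0 - fderiv ℝ W 0 (s • y)‖ ≤ ‖W (s • y)‖ + ‖W 0‖ + ‖fderiv ℝ W 0 (s • y)‖ := htri
        _ ≤ (A + |B| * (s * ‖y‖) * (1 + 2 * Real.sqrt s * Real.sqrt ‖y‖)) + ‖W 0‖ + ‖fderiv ℝ W 0‖ * (s * ‖y‖) := by
            gcongr
        _ = K0 + K1 * s + K2 * (s * Real.sqrt s) := by rw [hK0, hK1, hK2]; ring
    -- divide by `s²` and let `s → ∞`
    have hlim : Tendsto (fun s : ℝ => (K0 + K1 * s + K2 * (s * Real.sqrt s)) / s ^ 2) atTop (𝓝 0) := by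
      have e : ∀ s : ℝ, 0 < s → (K0 + K1 * s + K2 * (s * Real.sqrt s)) / s ^ 2 =
          K0 * s ^ (-(2 : ℝ)) + K1 * s ^ (-(1 : ℝ)) + K2 * s ^ (-(1 / 2 : ℝ)) := by
        intro s hs
        have h32 : s * Real.sqrt s = s ^ (3 / 2 : ℝ) := by
          rw [Real.sqrt_eq_rpow, show (3 / 2 : ℝ) = 1 + 1 / 2 by norm_num, Real.rpow_add hs, Real.rpow_one]
        have h2 : (s ^ 2 : ℝ) = s ^ (2 : ℝ) := by norm_cast
        have hA' : s ^ (-(2 : ℝ)) = 1 / s ^ 2 := by rw [Real.rpow_neg hs.le, h2, one_div]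
        have hB' : s ^ (-(1 : ℝ)) = s / s ^ 2 := by
          rw [show (-(1 : ℝ)) = 1 - 2 by norm_num, Real.rpow_sub hs, Real.rpow_one, h2]
        have hC' : s ^ (-(1 / 2 : ℝ)) = s * Real.sqrt s / s ^ 2 := by
          rw [h32, h2, ← Real.rpow_sub hs]
          norm_num
        rw [hA', hB', hC', add_div, add_div, mul_div_assoc, mul_div_assoc, mul_one_div]
      have t1 := (tendsto_rpow_neg_atTop (by norm_num : (0 : ℝ) < 2)).const_mul K0
      have t2 := (tendsto_rpow_neg_atTop (by norm_num : (0 : ℝ) < 1)).const_mul K1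
      have t3 := (tendsto_rpow_neg_atTop (by norm_num : (0 : ℝ) < 1 / 2)).const_mul K2
      have h0 := (t1.add t2).add t3
      simp only [mul_zero, add_zero] at h0
      exact h0.congr' (by filter_upwards [eventually_gt_atTop 0] with s hs using (e s hs).symm)
    have hle : ∀ᶠ s : ℝ in atTop, (1 / 2 : ℝ) * c ≤ (K0 + K1 * s + K2 * (s * Real.sqrt s)) / s ^ 2 := by
      filter_upwards [eventually_ge_atTop (1 / ‖y‖), eventually_gt_atTop 0] with s hs hs0
      rw [le_div_iff₀ (pow_pos hs0 2)]
      exact hray s hs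
    have hc0 : (1 / 2 : ℝ) * c ≤ 0 := ge_of_tendsto hlim hle
    have hcnn : 0 ≤ c := norm_nonneg _
    have : c = 0 := by linarith
    exact norm_eq_zero.mp this
  rw [htaylor x, hkill x, smul_zero, add_zero]

end General

/-! ### Curl-free ⟹ symmetric linear part; divergence-free ⟹ trace-free -/

/-- `curlCLM T = 0` ⟹ `T` is symmetric: `⟪Ty, z⟫ = ⟪y, Tz⟫` (symmetry of the matrix, `apply_single_comm_of_curlCLM_eq_zero`). [folklore] -/
theorem inner_clm_comm_of_curlCLM_eq_zero {T : EuclideanSpace ℝ (Fin 3) →L[ℝ] EuclideanSpace ℝ (Fin 3)} (h : curlCLM T = 0)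
    (y z : EuclideanSpace ℝ (Fin 3)) : ⟪T y, z⟫ = ⟪y, T z⟫ := by
  have hs := apply_single_comm_of_curlCLM_eq_zero h
  have hy : y = ∑ j, y j • EuclideanSpace.single j (1 : ℝ) := by
    simpa using ((EuclideanSpace.basisFun (Fin 3) ℝ).sum_repr y).symm
  have hz : z = ∑ i, z i • EuclideanSpace.single i (1 : ℝ) := by
    simpa using ((EuclideanSpace.basisFun (Fin 3) ℝ).sum_repr z).symm
  have hTy : T y = ∑ j, y j • T (EuclideanSpace.single j (1 : ℝ)) := by
    conv_lhs => rw [hy]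
    rw [map_sum]; simp_rw [map_smul]
  have hTz : T z = ∑ i, z i • T (EuclideanSpace.single i (1 : ℝ)) := by
    conv_lhs => rw [hz]
    rw [map_sum]; simp_rw [map_smul]
  rw [hTy, hTz, sum_inner, inner_sum]
  simp_rw [real_inner_smul_left, real_inner_smul_right]
  conv_lhs => arg 2; ext j; rw [hz, inner_sum]
  conv_rhs => arg 2; ext i; rw [hy, sum_inner]
  simp_rw [real_inner_smul_right, real_inner_smul_left, EuclideanSpace.inner_single_right, EuclideanSpace.inner_single_left]
  simp only [map_one, one_mul, Finset.mul_sum]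
  rw [Finset.sum_comm]
  refine Finset.sum_congr rfl fun i _ => Finset.sum_congr rfl fun j _ => ?_
  rw [hs i j, conj_trivial]
  ring

/-- ★★ **THE EXPORT.**  A smooth curl-free, divergence-free field `W` on `ℝ³` with `‖W x‖ ≤ A + B ‖x‖ (1 + |log ‖x‖|)` is affine,
`W x = W 0 + T x` with `T = DW(0)` SYMMETRIC (`⟪Ty, z⟫ = ⟪y, Tz⟫`) and TRACE-FREE. [folklore] -/
theorem affine_symm_traceFree_of_curl_div_log_growth
    {W : EuclideanSpace ℝ (Fin 3) → EuclideanSpace ℝ (Fin 3)} (hW : ContDiff ℝ (⊤ : ℕ∞) W)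
    (hcurl : ∀ x, curl W x = 0) (hdiv : VectorCalculus.IsDivFree W) {A B : ℝ}
    (hg : ∀ x, ‖W x‖ ≤ A + B * ‖x‖ * (1 + |Real.log ‖x‖|)) :
    (∀ x, W x = W 0 + fderiv ℝ W 0 x) ∧ (∀ y z, ⟪fderiv ℝ W 0 y, z⟫ = ⟪y, fderiv ℝ W 0 z⟫) ∧
      LinearMap.trace ℝ _ (fderiv ℝ W 0 : EuclideanSpace ℝ (Fin 3) →ₗ[ℝ] EuclideanSpace ℝ (Fin 3)) = 0 := by
  refine ⟨fun x => eq_add_fderiv_of_laplacian_eq_zero_of_log_growth hW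
    (laplacian_eq_zero_of_curl_eq_zero_of_isDivFree (hW.of_le (by norm_cast)) hcurl hdiv) hg x,
    inner_clm_comm_of_curlCLM_eq_zero (by rw [← curl_eq_curlCLM]; exact hcurl 0), ?_⟩
  have h := hdiv 0
  rw [VectorCalculus.divergence] at h
  exact h

end Summit.NavierStokesRegularity.NavierStokesRegularity.Theorems.PoloidalLiouville.Antidynamo

end
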